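import Mathlib
import Summits.CriticalPhenomena.SAWScalingLimit.Theorems.SAWRestrictionRigidityAxiomsOfLimitMarkovSplitContinuity
import Summits.CriticalPhenomena.SAWScalingLimit.Theorems.SAWRestrictionRigidityAxiomsOfLimitMarkovStrictExtension
import Summits.CriticalPhenomena.SAWScalingLimit.Theorems.SAWRestrictionRigidityAxiomsOfLimitMarkovEntryRepresentative
import Summits.CriticalPhenomena.SAWScalingLimit.Theorems.SAWRestrictionRigidityAxiomsOfLimitMarkovGenericLevels
import Summits.CriticalPhenomena.SAWScalingLimit.Theorems.SAWRestrictionRigidityAxiomsOfLimitMarkovThickeningLevels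
import HarnessLib

/-!
# Generic thickening levels: the split `(past, future)` is a.s. continuous for EVERY limit law

Crux `AxiomsOfLimit` (stmt-CriticalPhenomena-1370), line `registered` (= `split`), stub `stub_markovOfLimit`:
generic-level no-grazing (R2), composition (lead c4). Theorems only.

The Markov passage of this crux (parts 1–7, namespace `…Theorems.AxiomsOfLimitMarkov`) stops the lattice curves and
their limit at the closed thickenings `F_r := cthickening r F` of a closed set `F`, and its hypothesis (a) — joint
convergence in law of `(stopAt F_r, startFrom F_r)` — follows from convergence in law of the curves as soon as the
split map `c ↦ (c.stopAt F_r, c.startFrom F_r)` is continuous at `μ`-almost every class of the limit law `μ`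
(part 6, `tendsto_integral_split_of_ae_continuousAt`). This file proves that this is AUTOMATIC at Lebesgue-almost
every level `r > 0`, for every finite Borel measure `μ` on planar curve classes and every closed `F`
(no hypothesis on `μ`):

* `Curve.dist_toContinuousMap_const_eq`, `CurveClass.dist_stopAt_mk_const_le`,
  `CurveClass.dist_startFrom_mk_const_le`, `continuousAt_split_mk_const` — at a CONSTANT class the split map is
  continuous (both surgeries are `1`-Lipschitz there: every sub-curve of a curve uniformly close to the point `x`
  is uniformly close to `x`);
* `continuousAt_split_of_tendsto_nhdsLT` — at a class whose level pasts `s ↦ c.stopAt F_s` are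
  left-continuous at `r > 0`, the split map at `F_r` is continuous: by `stub_entryRepOfLeftContinuous` (fed with
  `stub_strictExtension`) the class is constant or has an immediate-entry representative, and part 6
  (`continuousAt_split`) applies to the latter;
* `ae_ae_continuousAt_split_cthickening` — for Lebesgue-a.e. `r`, `0 < r →` the split at `F_r` is continuous
  at `μ`-a.e. class (`stub_aeLevelLeftContinuous` + the previous item);
* `exists_seq_level` — from an a.e.-in-`r` property one extracts levels `r n ∈ (0, 1/(n+1))` having it, so
  `r n → 0⁺`; `exists_seq_ae_continuousAt_split` — the levels feeding part 7
  (`markov_clause_of_cthickening_seq`);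
* `markov_clause_of_level_passage` — the CONSOLIDATED reduction of the `markov` clause at a closed `F`: from
  `(lim)`, the exact lattice tensor identities and the kernel passage (tip stability, research input R1) at
  Lebesgue-a.e. thickening level, and tip continuity of the kernel along the level pasts (which
  `tendsto_integral_kernel_stopAt_cthickening` derives from weak continuity of the kernel at the past) — parts 2, 6,
  7 and R2 composed, with no no-grazing hypothesis left;
* `stub_genericLevelSplitContinuity`, `stub_markovClauseOfLevelPassage` — the registered sub-goals (notation-free
  restatements).

References: P. Billingsley, *Convergence of Probability Measures* (1999), Thm 2.7; M. Aizenman, A. Burchard,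
Duke Math. J. 99 (1999) §2.1; G. F. Lawler, O. Schramm, W. Werner, Acta Math. 187 (2001) §2. All [folklore].
-/

noncomputable section

open MeasureTheory Filter Topology Set Metric
open scoped ENNReal unitInterval

namespace Summit.CriticalPhenomena.SAWScalingLimit.Theorems.AxiomsOfLimitMarkov

open Literature.Probability.RandomPlanarGeometry

/-! ### The split map at constant classes -/

section Const

variable {E : Type*} [MetricSpace E]

/-- **The reparametrisation distance to a constant curve is the sup distance** (reparametrising a constant curve
does nothing). [folklore] -/
theorem Curve.dist_const_eq_dist_toContinuousMap (γ : Curve E) (x : E) :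
    dist γ (Curve.const x) = dist γ.toContinuousMap (Curve.const x).toContinuousMap := by
  refine le_antisymm (Curve.dist_le_dist_toContinuousMap _ _) ?_
  rw [Curve.dist_def]
  exact le_ciInf fun φ => by rw [Curve.reparam_const]

/-- **Sub-curves of a curve are no further from a point than the curve**: precomposing with any parameter
change `f : C(I, I)` does not increase the distance to a constant curve. [folklore] -/
theorem Curve.dist_comp_const_le (γ : Curve E) (f : C(I, I)) (x : E) :
    dist (⟨γ.toContinuousMap.comp f⟩ : Curve E) (Curve.const x) ≤ dist γ (Curve.const x) := by
  rw [Curve.dist_const_eq_dist_toContinuousMap γ x]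
  refine (Curve.dist_le_dist_toContinuousMap _ _).trans ?_
  refine (ContinuousMap.dist_le dist_nonneg).2 fun u => ?_
  exact ContinuousMap.dist_apply_le_dist (f := γ.toContinuousMap)
    (g := (Curve.const x).toContinuousMap) (f u)

/-- The distance of a class to a constant class is the distance of any representative to the constant curve.
[folklore] -/
theorem CurveClass.dist_mk_const_eq (c : CurveClass E) (x : E) :
    dist c (CurveClass.mk (Curve.const x)) = dist c.out (Curve.const x) := by
  conv_lhs => rw [← CurveClass.mk_out c]
  rfl

/-- **`stopAt F` is `1`-Lipschitz at constant classes**: `dist (c.stopAt F) [const x] ≤ dist c [const x]`.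
[folklore] -/
theorem CurveClass.dist_stopAt_mk_const_le (F : Set E) (c : CurveClass E) (x : E) :
    dist (c.stopAt F) (CurveClass.mk (Curve.const x)) ≤ dist c (CurveClass.mk (Curve.const x)) := by
  rw [CurveClass.dist_mk_const_eq c x]
  change dist (CurveClass.mk (c.out.stopAt F)) (CurveClass.mk (Curve.const x)) ≤ _
  rw [CurveClass.dist_mk_mk]
  exact Curve.dist_comp_const_le c.out _ x

/-- **`startFrom F` is `1`-Lipschitz at constant classes**: `dist (c.startFrom F) [const x] ≤ dist c [const x]`.
[folklore] -/
theorem CurveClass.dist_startFrom_mk_const_le (F : Set E) (c : CurveClass E) (x : E) :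
    dist (c.startFrom F) (CurveClass.mk (Curve.const x)) ≤ dist c (CurveClass.mk (Curve.const x)) := by
  rw [CurveClass.dist_mk_const_eq c x]
  change dist (CurveClass.mk (c.out.startFrom F)) (CurveClass.mk (Curve.const x)) ≤ _
  rw [CurveClass.dist_mk_mk]
  exact Curve.dist_comp_const_le c.out _ x

/-- `stopAt F` is continuous at every constant class. [folklore] -/
theorem CurveClass.continuousAt_stopAt_mk_const (F : Set E) (x : E) :
    ContinuousAt (CurveClass.stopAt F) (CurveClass.mk (Curve.const x)) := by
  rw [Metric.continuousAt_iff]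
  refine fun ε hε => ⟨ε, hε, fun c hc => ?_⟩
  rw [CurveClass.stopAt_mk_const]
  exact (CurveClass.dist_stopAt_mk_const_le F c x).trans_lt hc

/-- `startFrom F` is continuous at every constant class. [folklore] -/
theorem CurveClass.continuousAt_startFrom_mk_const (F : Set E) (x : E) :
    ContinuousAt (CurveClass.startFrom F) (CurveClass.mk (Curve.const x)) := by
  rw [Metric.continuousAt_iff]
  refine fun ε hε => ⟨ε, hε, fun c hc => ?_⟩
  rw [CurveClass.startFrom_mk_const]
  exact (CurveClass.dist_startFrom_mk_const_le F c x).trans_lt hc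

/-- **The split map is continuous at constant classes.** [folklore] -/
theorem continuousAt_split_mk_const (F : Set E) (x : E) :
    ContinuousAt (fun c : CurveClass E => (c.stopAt F, c.startFrom F)) (CurveClass.mk (Curve.const x)) :=
  (CurveClass.continuousAt_stopAt_mk_const F x).prodMk (CurveClass.continuousAt_startFrom_mk_const F x)

end Const

/-! ### Left-continuity levels are continuity levels of the split -/

/-- **At a left-continuity level of the level pasts, the split map is continuous.** If the level pasts
`s ↦ c.stopAt (cthickening s F)` of the class `c` are left-continuous at `r > 0` (`F` closed), then
`c' ↦ (c'.stopAt F_r, c'.startFrom F_r)` is continuous at `c`: by `stub_entryRepOfLeftContinuous` (with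
`stub_strictExtension`) `c` is a constant class (`continuousAt_split_mk_const`) or has an immediate-entry
representative (part 6 `continuousAt_split`). [folklore] -/
theorem continuousAt_split_of_tendsto_nhdsLT {F : Set ℂ} (hF : IsClosed F) {r : ℝ} (hr : 0 < r)
    {c : CurveClass ℂ}
    (hlc : Tendsto (fun s : ℝ => c.stopAt (cthickening s F)) (𝓝[<] r) (𝓝 (c.stopAt (cthickening r F)))) :
    ContinuousAt (fun c : CurveClass ℂ => (c.stopAt (cthickening r F), c.startFrom (cthickening r F))) c := by
  rcases stub_entryRepOfLeftContinuous stub_strictExtension F hF r hr c hlc with ⟨x, rfl⟩ | ⟨γ, rfl, hγ⟩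
  · exact continuousAt_split_mk_const _ x
  · exact continuousAt_split isClosed_cthickening hγ

/-- **Generic levels are continuity levels of the split, almost surely, for every law.** For every finite Borel
measure `μ` on `CurveClass ℂ` and closed `F`: for Lebesgue-a.e. `r`, if `0 < r` then the split map at
`cthickening r F` is continuous at `μ`-a.e. class. [folklore] -/
theorem ae_ae_continuousAt_split_cthickening (μ : Measure (CurveClass ℂ)) [IsFiniteMeasure μ] {F : Set ℂ}
    (hF : IsClosed F) :
    ∀ᵐ r ∂(volume : Measure ℝ), 0 < r → ∀ᵐ c ∂μ,
      ContinuousAt (fun c : CurveClass ℂ => (c.stopAt (cthickening r F), c.startFrom (cthickening r F))) c := by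
  filter_upwards [stub_aeLevelLeftContinuous μ F hF] with r hr hr0
  filter_upwards [hr] with c hc
  exact continuousAt_split_of_tendsto_nhdsLT hF hr0 hc

/-! ### Extracting a vanishing sequence of good levels -/

/-- **A Lebesgue-a.e. property of reals holds somewhere in every nondegenerate interval.** [folklore] -/
theorem exists_mem_Ioo_of_ae {p : ℝ → Prop} (h : ∀ᵐ r ∂(volume : Measure ℝ), p r) {a b : ℝ} (hab : a < b) :
    ∃ r ∈ Ioo a b, p r := by
  have hne : (volume : Measure ℝ).restrict (Ioo a b) ≠ 0 := by
    rw [Ne, Measure.restrict_eq_zero, Real.volume_Ioo]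
    exact (ENNReal.ofReal_pos.2 (sub_pos.2 hab)).ne'
  haveI : (ae ((volume : Measure ℝ).restrict (Ioo a b))).NeBot := ae_neBot.2 hne
  have h' : ∀ᵐ r ∂((volume : Measure ℝ).restrict (Ioo a b)), r ∈ Ioo a b ∧ p r :=
    (ae_restrict_mem measurableSet_Ioo).and (ae_restrict_of_ae h)
  exact h'.exists.imp fun r hr => ⟨hr.1, hr.2⟩

/-- **Levels in `(0, 1/(n+1))` with an a.e. property**: from `∀ᵐ r, p r` one extracts positive levels
`r n < 1/(n+1)` (so `r n → 0`) each satisfying `p`. [folklore] -/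
theorem exists_seq_level {p : ℝ → Prop} (h : ∀ᵐ r ∂(volume : Measure ℝ), p r) :
    ∃ r : ℕ → ℝ, (∀ n, 0 < r n) ∧ Tendsto r atTop (𝓝 0) ∧ ∀ n, p (r n) := by
  have hn : ∀ n : ℕ, ∃ r ∈ Ioo (0 : ℝ) (1 / ((n : ℝ) + 1)), p r := fun n =>
    exists_mem_Ioo_of_ae h (by positivity)
  choose r hr hp using hn
  refine ⟨r, fun n => (hr n).1, ?_, hp⟩
  refine squeeze_zero (fun n => (hr n).1.le) (fun n => (hr n).2.le) ?_
  exact tendsto_one_div_add_atTop_nhds_zero_nat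

/-- **Good levels for the Markov passage.** For every finite Borel measure `μ` on `CurveClass ℂ` and closed `F`
there are levels `r n > 0`, `r n → 0`, at each of which the split map at `cthickening (r n) F` is continuous at
`μ`-a.e. class; moreover the levels can be taken inside any prescribed Lebesgue-a.e. set of reals (an extra a.e.
requirement `q`, e.g. the levels at which lattice-side hypotheses hold). [folklore] -/
theorem exists_seq_ae_continuousAt_split (μ : Measure (CurveClass ℂ)) [IsFiniteMeasure μ] {F : Set ℂ}
    (hF : IsClosed F) {q : ℝ → Prop} (hq : ∀ᵐ r ∂(volume : Measure ℝ), q r) :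
    ∃ r : ℕ → ℝ, (∀ n, 0 < r n) ∧ Tendsto r atTop (𝓝 0) ∧ (∀ n, q (r n)) ∧ ∀ n, ∀ᵐ c ∂μ,
      ContinuousAt (fun c : CurveClass ℂ =>
        (c.stopAt (cthickening (r n) F), c.startFrom (cthickening (r n) F))) c := by
  obtain ⟨r, hr0, hr, hp⟩ := exists_seq_level ((ae_ae_continuousAt_split_cthickening μ hF).and hq)
  exact ⟨r, hr0, hr, fun n => (hp n).2, fun n => (hp n).1 (hr0 n)⟩
/-! ### The `markov` clause from lattice passage at generic levels and tip continuity -/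

section Passage

open ProbabilityTheory BoundedContinuousFunction

variable {Ωs : ℕ → Type*} [∀ n, MeasurableSpace (Ωs n)]

/-- **The `markov` clause at a closed `F` from lattice passage at GENERIC thickening levels** (parts 2, 6, 7 and
R2 composed; no no-grazing hypothesis). Let the lattice curve classes `C n` converge in law to the probability
measure `P` (`(lim)`), let `κ` be a sub-probability kernel (the candidate conditional law of the future given the
past), and suppose that for Lebesgue-a.e. level `r > 0` the lattice data at `F_r := cthickening r F` are available:
sub-probability kernels `κs r n` disintegrating the lattice future given the lattice past in tensor form (exact on
the lattice: part 4), measurable supports `K r n` of the lattice pasts, and CONTINUOUS CONVERGENCE of `κs r n` to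
`κ` along supported pasts converging to `P ∘ (stopAt F_r)⁻¹`-a.e. past (tip stability, the research input R1).
If moreover `κ` is weakly continuous along the level pasts `γ.stopAt F_s → γ.stopAt F` (`s → 0⁺`) of `P`-a.e. `γ`
(tip continuity), then `P` disintegrates along `(stopAt F, startFrom F)` through `κ` — the `markov` clause of
`ChordalFamily.IsMarkovExtension` at `F`. Proof: pick levels `r n → 0⁺` in the a.e. set at which, in addition, the
split is continuous at `P`-a.e. class (`exists_seq_ae_continuousAt_split`); there hypothesis (a) of part 3 holds
(part 6), so the tensor identity passes to `P` at `F_{r n}` (part 2), and part 7 lets `n → ∞`. [folklore] -/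
theorem markov_clause_of_level_passage (P : Measure (CurveClass ℂ)) [IsProbabilityMeasure P] {F : Set ℂ}
    (hF : IsClosed F) (κ : Kernel (CurveClass ℂ) (CurveClass ℂ)) (hκ : ∀ p, κ p univ ≤ 1)
    (Ps : ∀ n, Measure (Ωs n)) [∀ n, IsProbabilityMeasure (Ps n)] (C : ∀ n, Ωs n → CurveClass ℂ)
    (hC : ∀ n, Measurable (C n))
    (hlim : ∀ f : CurveClass ℂ →ᵇ ℝ, Tendsto (fun n => ∫ ω, f (C n ω) ∂Ps n) atTop (𝓝 (∫ γ, f γ ∂P)))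
    (κs : ℝ → ℕ → Kernel (CurveClass ℂ) (CurveClass ℂ)) (hκs : ∀ r n p, κs r n p univ ≤ 1)
    (K : ℝ → ℕ → Set (CurveClass ℂ)) (hKm : ∀ r n, MeasurableSet (K r n))
    (hlat : ∀ᵐ r ∂(volume : Measure ℝ), 0 < r →
      (∀ n, ∀ᵐ ω ∂Ps n, (C n ω).stopAt (cthickening r F) ∈ K r n) ∧
      (∀ g : CurveClass ℂ →ᵇ ℝ, ∀ᵐ p ∂(P.map (CurveClass.stopAt (cthickening r F))),
        ∀ u : ℕ → ℕ, StrictMono u → ∀ xs : ℕ → CurveClass ℂ, (∀ j, xs j ∈ K r (u j)) →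
          Tendsto xs atTop (𝓝 p) →
            Tendsto (fun j => ∫ η, g η ∂(κs r (u j) (xs j))) atTop (𝓝 (∫ η, g η ∂(κ p)))) ∧
      (∀ (n : ℕ) (f g : CurveClass ℂ →ᵇ ℝ),
        ∫ ω, f ((C n ω).stopAt (cthickening r F)) * g ((C n ω).startFrom (cthickening r F)) ∂Ps n =
          ∫ ω, f ((C n ω).stopAt (cthickening r F)) *
            (∫ η, g η ∂(κs r n ((C n ω).stopAt (cthickening r F)))) ∂Ps n))
    (hTC : ∀ g : CurveClass ℂ →ᵇ ℝ, ∀ᵐ γ ∂P,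
      Tendsto (fun s : ℝ => ∫ η, g η ∂(κ (γ.stopAt (cthickening s F)))) (𝓝[>] 0)
        (𝓝 (∫ η, g η ∂(κ (γ.stopAt F)))))
    {S T : Set (CurveClass ℂ)} (hS : MeasurableSet S) (hT : MeasurableSet T) :
    P (CurveClass.stopAt F ⁻¹' S ∩ CurveClass.startFrom F ⁻¹' T) =
      ∫⁻ γ in CurveClass.stopAt F ⁻¹' S, κ (γ.stopAt F) T ∂P := by
  haveI : IsFiniteKernel κ := ⟨⟨1, ENNReal.one_lt_top, hκ⟩⟩
  obtain ⟨r, hr0, hr, hq, hcont⟩ := exists_seq_ae_continuousAt_split P hF hlat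
  -- the levels `r n → 0` approach `0` from the right
  have hrw : Tendsto r atTop (𝓝[>] 0) :=
    tendsto_nhdsWithin_of_tendsto_nhds_of_eventually_within r hr (Eventually.of_forall hr0)
  refine markov_clause_of_cthickening_seq P κ hF hr (fun g => ?_) (fun n f g => ?_) hS hT
  · filter_upwards [hTC g] with γ hγ
    exact hγ.comp hrw
  · obtain ⟨hK, hc, hident⟩ := hq n (hr0 n)
    have hjoint := tendsto_integral_split_of_ae_continuousAt hC isClosed_cthickening hlim (hcont n)
    exact integral_mul_eq_integral_mul_integral_kernel_of_tendsto
      (X := fun m ω => (C m ω).stopAt (cthickening (r n) F))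
      (Y := fun m ω => (C m ω).startFrom (cthickening (r n) F))
      (X₀ := CurveClass.stopAt (cthickening (r n) F)) (Y₀ := CurveClass.startFrom (cthickening (r n) F))
      (μ := P) (fun m => (CurveClass.measurable_stopAt isClosed_cthickening).comp (hC m))
      (CurveClass.measurable_stopAt isClosed_cthickening) hjoint (κs (r n)) κ (hκs (r n)) hκ (hKm (r n)) hK
      (hc g) (fun m => hident m f g)

/-- **Tip continuity from weak continuity of the kernel at the past.** If `p ↦ ∫ g dκ p` is continuous at the
past `γ.stopAt F` then it converges along the level pasts `γ.stopAt (cthickening s F) → γ.stopAt F` (`s → 0⁺`;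
right-continuity of the level pasts at level `0`, `tendsto_stopAt_cthickening_nhdsGE`, and
`cthickening 0 F = F` for closed `F`). [folklore] -/
theorem tendsto_integral_kernel_stopAt_cthickening {F : Set ℂ} (hF : IsClosed F)
    (κ : Kernel (CurveClass ℂ) (CurveClass ℂ)) (g : CurveClass ℂ →ᵇ ℝ) (γ : CurveClass ℂ)
    (hκ : ContinuousAt (fun p : CurveClass ℂ => ∫ η, g η ∂(κ p)) (γ.stopAt F)) :
    Tendsto (fun s : ℝ => ∫ η, g η ∂(κ (γ.stopAt (cthickening s F)))) (𝓝[>] 0)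
      (𝓝 (∫ η, g η ∂(κ (γ.stopAt F)))) := by
  have h0 : γ.stopAt (cthickening 0 F) = γ.stopAt F := by rw [cthickening_zero, hF.closure_eq]
  have hp : Tendsto (fun s : ℝ => γ.stopAt (cthickening s F)) (𝓝[>] 0) (𝓝 (γ.stopAt F)) := by
    rw [← h0]
    exact (tendsto_stopAt_cthickening_nhdsGE F γ 0).mono_left (nhdsWithin_mono _ Ioi_subset_Ici_self)
  exact hκ.tendsto.comp hp

end Passage


/-! ### Registered sub-goals of crux stmt-CriticalPhenomena-1370 (line `registered`, stub `stub_markovOfLimit`) -/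

/-- **Registered sub-goal `stub_genericLevelSplitContinuity`** (crux stmt-CriticalPhenomena-1370, generic-level
no-grazing R2, composition): for every finite Borel measure on planar curve classes and every closed `F`, for
Lebesgue-a.e. level `r`, if `0 < r` the split `c ↦ (c.stopAt (cthickening r F), c.startFrom (cthickening r F))` is
continuous at a.e. class — so hypothesis (a) of the Markov passage (joint convergence of past and future, part 3)
holds at generic thickening levels for EVERY limit law (part 6 `tendsto_integral_split_of_ae_continuousAt`).
[folklore] -/
theorem stub_genericLevelSplitContinuity :
    ∀ (μ : MeasureTheory.Measure (Literature.Probability.RandomPlanarGeometry.CurveClass ℂ)) [MeasureTheory.IsFiniteMeasure μ] (F : Set ℂ), IsClosed F → Filter.Eventually (fun r : ℝ => 0 < r → Filter.Eventually (fun c : Literature.Probability.RandomPlanarGeometry.CurveClass ℂ => ContinuousAt (fun c' : Literature.Probability.RandomPlanarGeometry.CurveClass ℂ => (c'.stopAt (Metric.cthickening r F), c'.startFrom (Metric.cthickening r F))) c) (MeasureTheory.ae μ)) (MeasureTheory.ae (MeasureTheory.volume : MeasureTheory.Measure ℝ)) :=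
  fun μ _ _ hF => ae_ae_continuousAt_split_cthickening μ hF


/-- **Registered sub-goal `stub_markovClauseOfLevelPassage`** (crux stmt-CriticalPhenomena-1370, Markov passage consolidated:
`markov_clause_of_level_passage` with all binders explicit, notation-free, lattice sample spaces at universe level `0`): the
`markov` clause of `ChordalFamily.IsMarkovExtension` at a closed `F` for a limit law `P` follows from `(lim)`, the exact
lattice tensor identities and the kernel passage (tip stability, R1) at Lebesgue-a.e. thickening level, and tip continuity of
the kernel — with NO no-grazing hypothesis (R2 is now a theorem). [folklore] -/
theorem stub_markovClauseOfLevelPassage :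
    ∀ (P : MeasureTheory.Measure (Literature.Probability.RandomPlanarGeometry.CurveClass ℂ)) [MeasureTheory.IsProbabilityMeasure P] (F : Set ℂ), IsClosed F → ∀ (κ : ProbabilityTheory.Kernel (Literature.Probability.RandomPlanarGeometry.CurveClass ℂ) (Literature.Probability.RandomPlanarGeometry.CurveClass ℂ)), (∀ p, κ p Set.univ ≤ 1) → ∀ (Ωs : ℕ → Type) [∀ n, MeasurableSpace (Ωs n)] (Ps : ∀ n, MeasureTheory.Measure (Ωs n)) [∀ n, MeasureTheory.IsProbabilityMeasure (Ps n)] (C : ∀ n, Ωs n → Literature.Probability.RandomPlanarGeometry.CurveClass ℂ), (∀ n, Measurable (C n)) → (∀ f : BoundedContinuousFunction (Literature.Probability.RandomPlanarGeometry.CurveClass ℂ) ℝ, Filter.Tendsto (fun n => MeasureTheory.integral (Ps n) (fun ω => f (C n ω))) Filter.atTop (nhds (MeasureTheory.integral P (fun γ => f γ)))) → ∀ (κs : ℝ → ℕ → ProbabilityTheory.Kernel (Literature.Probability.RandomPlanarGeometry.CurveClass ℂ) (Literature.Probability.RandomPlanarGeometry.CurveClass ℂ)), (∀ r n p, κs r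 n p Set.univ ≤ 1) → ∀ (K : ℝ → ℕ → Set (Literature.Probability.RandomPlanarGeometry.CurveClass ℂ)), (∀ r n, MeasurableSet (K r n)) → Filter.Eventually (fun r : ℝ => 0 < r → (∀ n, Filter.Eventually (fun ω => (C n ω).stopAt (Metric.cthickening r F) ∈ K r n) (MeasureTheory.ae (Ps n))) ∧ (∀ g : BoundedContinuousFunction (Literature.Probability.RandomPlanarGeometry.CurveClass ℂ) ℝ, Filter.Eventually (fun p => ∀ u : ℕ → ℕ, StrictMono u → ∀ xs : ℕ → Literature.Probability.RandomPlanarGeometry.CurveClass ℂ, (∀ j, xs j ∈ K r (u j)) → Filter.Tendsto xs Filter.atTop (nhds p) → Filter.Tendsto (fun j => MeasureTheory.integral (κs r (u j) (xs j)) (fun η => g η)) Filter.atTop (nhds (MeasureTheory.integral (κ p) (fun η => g η)))) (MeasureTheory.ae (P.map (Literature.Probability.RandomPlanarGeometry.CurveClass.stopAt (Metric.cthickening r F))))) ∧ (∀ (n : ℕ) (f g : BoundedContinuousFunction (Literature.Probability.RandomPlanarGeometry.CurveClass ℂ) ℝ), MeasureTheory.integral (Ps n) (fun ω => f ((C n ω).stopAt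 (Metric.cthickening r F)) * g ((C n ω).startFrom (Metric.cthickening r F))) = MeasureTheory.integral (Ps n) (fun ω => f ((C n ω).stopAt (Metric.cthickening r F)) * MeasureTheory.integral (κs r n ((C n ω).stopAt (Metric.cthickening r F))) (fun η => g η)))) (MeasureTheory.ae (MeasureTheory.volume : MeasureTheory.Measure ℝ)) → (∀ g : BoundedContinuousFunction (Literature.Probability.RandomPlanarGeometry.CurveClass ℂ) ℝ, Filter.Eventually (fun γ => Filter.Tendsto (fun s : ℝ => MeasureTheory.integral (κ (γ.stopAt (Metric.cthickening s F))) (fun η => g η)) (nhdsWithin 0 (Set.Ioi 0)) (nhds (MeasureTheory.integral (κ (γ.stopAt F)) (fun η => g η)))) (MeasureTheory.ae P)) → ∀ S T : Set (Literature.Probability.RandomPlanarGeometry.CurveClass ℂ), MeasurableSet S → MeasurableSet T → P (Literature.Probability.RandomPlanarGeometry.CurveClass.stopAt F ⁻¹' S ∩ Literature.Probability.RandomPlanarGeometry.CurveClass.startFrom F ⁻¹' T) = MeasureTheory.lintegral (P.restrict (Literature.Probability.RandomPlanarGeometry.CurveClass.stopAt F ⁻¹' S)) (fun γ => κ (γ.stopAt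 F) T) :=
  fun P _ _ hF κ hκ _ _ Ps _ C hC hlim κs hκs K hKm hlat hTC _ _ hS hT =>
    markov_clause_of_level_passage P hF κ hκ Ps C hC hlim κs hκs K hKm hlat hTC hS hT

end Summit.CriticalPhenomena.SAWScalingLimit.Theorems.AxiomsOfLimitMarkov

end
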